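import Summits.Ventures.PercRepro.S2DichotomyTools
import Summits.Ventures.PercRepro.S2TailCell
import Summits.Ventures.PercRepro.S2SpanningCount
import Summits.Ventures.PercRepro.S2CountsCell
import Summits.Ventures.PercRepro.S2SpreadTail
import Summits.Ventures.PercRepro.S2FlatSharp
import Summits.Ventures.PercRepro.S2BasesTriangles
import Summits.Ventures.PercRepro.S2FifteenSevenScaled
import Summits.Ventures.PercRepro.S2ColoopSharp
import Summits.Ventures.PercRepro.S2PhiFifteenFive
import Summits.Ventures.PercRepro.S2CapFree
import Summits.Ventures.PercRepro.TriangleCapEightI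
import Summits.Ventures.PercRepro.RankLevelSetFourCircuitNullityFour
import Summits.Ventures.PercRepro.S1FiveCircuitBase

/-!
# PercRepro — S2: THE CELL `(15, 7)` OF THE `q = 5` WINDOW — THE CONCENTRATED TAIL AND THE TRIANGLE TRADE-OFF (p7, gen 12; sub-claim S2)

The coloop-free cell: the cases `ν = 6, 5, 4` (a set `W` of nullity `ν` on `≤ 5 + ν` points) by the concentrated tail (S2TailCell / S2SpanningCount,
the kit's own top counts: `full`, `full`, `pay`); the SPREAD case (no set of nullity `4` on `≤ 9` points: rank-`5` sets `≤ 8` points, rank-`4` sets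
`≤ 7`) by the TRIANGLE TRADE-OFF — with `≤ 8` triangles the kit's spread count (`57,692`) fits the kit's need (`58,311`); with `≥ 9` triangles the
count with the triangle term (`topCount_le_flat_sharp`, `59,907`) fits the need of a tail with the spread rank part (`ncard_eRk_le_five_le_spread`)
and the spanning sets cut by three triangles' Bonferroni on the bases (`ncard_spanning_add_le_of_three_triangles`: `≤ 187,780`), slack `68/1024`,
need `60,396` (0.9919). The coloop case: the scaled cell `(14, 7)` on the standard caps at `K₁ = 16688` (S2FifteenSevenScaled) lifted by the
sharpened coloop step. **`ThmN.c025_core_five_fifteen_seven (M) [M.Finite] (hR : ρ(E) = 15) (hn : |E| = 22) (hfree) : RLS M 15 5`**.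
Every numeral from lean-drafts/p7/g12/mining/gencell7.py (spread.py, selectk.py). Axioms: standard.
-/

open scoped Matroid

namespace PercRepro

namespace ThmN

open Set

variable {α : Type}

/-- The coloop-free caps at `(15, 7)`: `s₃ ≤ 11`, `s₄ ≤ 56` (`⌊22·46/18⌋`, the series-class averaging on `avgChain16 6`), `s₅ ≤ 302` (`⌊22·234/17⌋`)
on every `e`-free core of nullity `7` on `22` points without coloops. -/
theorem caps_fifteen_seven_cf (M : Matroid α) [M.Finite]
    (hd : M.E.encard = M.eRank + ((7 : ℕ) : ℕ∞)) (hn : M.E.ncard = 15 + 7)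
    (hfree : ∀ e ∈ M.E, ∃ A ⊆ M.E \ {e}, e ∉ M.closure A ∧ e ∉ M.closure ((M.E \ {e}) \ A)) (hK : ∀ e, ¬ M.IsColoop e) :
    {C : Set α | M.IsCircuit C ∧ C.ncard = 3}.ncard ≤ 11 ∧
      {C : Set α | M.IsCircuit C ∧ C.ncard = 4}.ncard ≤ 56 ∧
        {C : Set α | M.IsCircuit C ∧ C.ncard = 5}.ncard ≤ 302 := by
  have hs3 := TriangleCap.core_ncard_triangles_le_cq3 M hfree hd
  rw [show TriangleCap.cq3 7 = 11 by decide] at hs3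
  have hcol : M.coloops = ∅ := S2.coloops_eq_empty_of_forall_not M hK
  have hm : 22 ≤ (M.E \ M.coloops).ncard := by
    rw [hcol, Set.sdiff_empty, hn]
  have hd' : M.E.encard = M.eRank + (((6 : ℕ) : ℕ∞) + 1) := by
    rw [hd]; norm_num
  have h := S1.ncard_fourCircuits_sub_div_le_of_nonColoops M hfree hd' (by norm_num) hm (B := 46)
    (fun M' _ hfree' hd'' => by
      have h := ncard_fourCircuits_le_avgChain16 6 M' hfree' hd''
      rw [show avgChain16 6 = 46 by decide] at h
      exact h)
  have hs4 : {C : Set α | M.IsCircuit C ∧ C.ncard = 4}.ncard ≤ 56 := by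
    have := S1.le_mul_div_of_sub_div_le (by norm_num : 4 < 22) h
    omega
  have hs5 := S2.ncard_fiveCircuits_le_of_no_coloop M hfree hd' hK (by omega)
  rw [hn] at hs5
  have h5 : (15 + 7) * S1.avgChain5b 6 / (15 + 7 - 5) = 302 := by
    rw [show S1.avgChain5b 6 = 234 by decide]
  rw [h5] at hs5
  exact ⟨hs3, hs4, hs5⟩

/-- The tail side of the cell `(15, 7)` on the caps `11 / 56 / 302` with the spanning count `S` a parameter: the kit's rank-`≤ 5` part is exactly
`2159401439 / 16450 = 131,270.6`. -/
theorem tail_fifteen_seven_cf (S m : ℕ) (h : (1024 : ℚ) * ((2159401439 / 16450 : ℚ) + (S : ℚ)) ≤ (m : ℚ) * 2 ^ 22) :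
    1024 * ((((15 + 7).choose 4 : ℚ) +
      (∑ j ∈ Finset.range 6, (Nat.choose (min 5 ((7 + 3) / 2 + 1 - 2)) j : ℚ) / (((j + 1) + 3 * (j + 1).choose 2 + 3 * (j + 1).choose 3 + 2 * (j + 1).choose 4 : ℕ) : ℚ)) *
        ((11 * (15 + 7 - 3).choose 2 + 56 * (15 + 7 - 4) + 302 : ℕ) : ℚ) +
      ((∑ j ∈ Finset.range 6, (Nat.choose 5 j : ℚ) / (((j + 1) + 3 * (j + 1).choose 2 + 3 * (j + 1).choose 3 + 2 * (j + 1).choose 4 : ℕ) : ℚ)) -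
        (∑ j ∈ Finset.range 6, (Nat.choose (min 5 ((7 + 3) / 2 + 1 - 2)) j : ℚ) / (((j + 1) + 3 * (j + 1).choose 2 + 3 * (j + 1).choose 3 + 2 * (j + 1).choose 4 : ℕ) : ℚ))) *
        ((10 : ℕ).choose 5 : ℚ)) +
      (((15 + 7).choose 3 * 2 ^ 3 + (15 + 7).choose 2 * 2 + (15 + 7) + 1 : ℕ) : ℚ) +
      (((15 + 7).choose 5 : ℚ) + (∑ j ∈ Finset.range (7), (Nat.choose (min 13 ((7 + 6) / 2 + 1 - 2)) j : ℚ) / (((j + 1) + 3 * (j + 1).choose 2 + 3 * (j + 1).choose 3 + 2 * (j + 1).choose 4 : ℕ) : ℚ)) * ((11 * (15 + 7 - 3).choose 3 + 56 * (15 + 7 - 4).choose 2 + 302 * (15 + 7 - 5) + (7 + 5).choose 6 : ℕ) : ℚ) +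
        ((∑ j ∈ Finset.range (7), (Nat.choose (min 19 (5 + 7) - 6) j : ℚ) / (((j + 1) + 3 * (j + 1).choose 2 + 3 * (j + 1).choose 3 + 2 * (j + 1).choose 4 : ℕ) : ℚ)) - (∑ j ∈ Finset.range (7), (Nat.choose (min 13 ((7 + 6) / 2 + 1 - 2)) j : ℚ) / (((j + 1) + 3 * (j + 1).choose 2 + 3 * (j + 1).choose 3 + 2 * (j + 1).choose 4 : ℕ) : ℚ))) *
        ((min 19 (5 + 7)).choose 6 : ℚ)) +
      (S : ℚ)) ≤ (m : ℚ) * 2 ^ (15 + 7) := by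
  have hsm : (∑ j ∈ Finset.range (7), (Nat.choose (min 13 ((7 + 6) / 2 + 1 - 2)) j : ℚ) / (((j + 1) + 3 * (j + 1).choose 2 + 3 * (j + 1).choose 3 + 2 * (j + 1).choose 4 : ℕ) : ℚ)) = 12767 / 4230 := by
    norm_num [Finset.sum_range_succ, Nat.choose]
  have hsg : (∑ j ∈ Finset.range (7), (Nat.choose (min 19 (5 + 7) - 6) j : ℚ) / (((j + 1) + 3 * (j + 1).choose 2 + 3 * (j + 1).choose 3 + 2 * (j + 1).choose 4 : ℕ) : ℚ)) = 414767 / 103635 := by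
    norm_num [Finset.sum_range_succ, Nat.choose]
  have hs4m : (∑ j ∈ Finset.range 6, (Nat.choose (min 5 ((7 + 3) / 2 + 1 - 2)) j : ℚ) / (((j + 1) + 3 * (j + 1).choose 2 + 3 * (j + 1).choose 3 + 2 * (j + 1).choose 4 : ℕ) : ℚ)) = 523 / 225 := by
    norm_num [Finset.sum_range_succ, Nat.choose]
  have hs4g : (∑ j ∈ Finset.range 6, (Nat.choose 5 j : ℚ) / (((j + 1) + 3 * (j + 1).choose 2 + 3 * (j + 1).choose 3 + 2 * (j + 1).choose 4 : ℕ) : ℚ)) = 12767 / 4230 := by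
    norm_num [Finset.sum_range_succ, Nat.choose]
  rw [hsm, hsg, hs4m, hs4g]
  norm_num [Nat.choose] at h ⊢
  linarith

/-- **The coloop-free cell `(15, 7)`**: `RLS M 15 5` on every `e`-free core of rank `15` on `22` points without coloops — the cases
`ν = 6, 5, 4` by the concentrated tail (the kit's top counts, the spanning sets below `W`), the spread case by the TRIANGLE TRADE-OFF:
`≤ 8` triangles — the kit's spread count `57692` against the kit's need `58311`; `≥ 9` triangles — `topCount_le_flat_sharp`
(`59907`), the spread rank part of the tail (`441094 / 5`) and three triangles' Bonferroni on the bases (`#spanning ≤ 187780`): slack `68/1024`,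
need `60396`. -/
theorem c025_fifteen_seven_cf (M : Matroid α) [M.Finite]
    (hR : M.eRank = ((15 : ℕ) : ℕ∞)) (hn : M.E.ncard = 15 + 7)
    (hfree : ∀ e ∈ M.E, ∃ A ⊆ M.E \ {e}, e ∉ M.closure A ∧ e ∉ M.closure ((M.E \ {e}) \ A)) (hK : ∀ e, ¬ M.IsColoop e) :
    RLS M 15 5 := by
  classical
  have hd : M.E.encard = M.eRank + ((7 : ℕ) : ℕ∞) := by
    rw [hR, ← M.ground_finite.cast_ncard_eq, hn]
    push_cast
    ring
  obtain ⟨hs3, hs4, hs5⟩ := caps_fifteen_seven_cf M hd hn hfree hK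
  have full : ∀ (k : ℕ) {W : Set α}, W ⊆ M.E → W.encard = M.eRk W + k →
      Matroid.topCount M 15 5 ≤ ∑ m ∈ Finset.Icc 5 7, ∑ j ∈ Finset.Icc (m + k - 7) m,
        W.ncard.choose j * (15 + 7 - W.ncard).choose (m - j) := by
    intro k W hW hWk
    refine (S2.topCount_le_sum_spanning M hR hd 5).trans ?_
    refine Finset.sum_le_sum (fun m _ => ?_)
    have h := S2.ncard_spanning_compl_le_of_nullity M hW hd hWk (m := m)
    rw [hn] at h
    exact h
  have span : ∀ (k : ℕ) {W : Set α}, W ⊆ M.E → W.encard = M.eRk W + k →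
      {X : Set α | X ⊆ M.E ∧ M.eRk X = M.eRank}.ncard ≤ ∑ m ∈ Finset.range (7 + 1), ∑ j ∈ Finset.Icc (m + k - 7) m,
        W.ncard.choose j * (15 + 7 - W.ncard).choose (m - j) := by
    intro k W hW hWk
    have h := S2.ncard_spanning_le_of_nullity M hW hd hWk
    rw [hn] at h
    exact h
  have cell : ∀ (U S m : ℕ), Matroid.topCount M 15 5 ≤ U → {X : Set α | X ⊆ M.E ∧ M.eRk X = M.eRank}.ncard ≤ S → m ≤ 1024 →
      1024 * (U : ℚ) ≤ ((1024 - m : ℕ) : ℚ) * 2 ^ (7 - 5) * (16173 : ℚ) →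
      (1024 : ℚ) * ((2159401439 / 16450 : ℚ) + (S : ℚ)) ≤ (m : ℚ) * 2 ^ 22 → RLS M 15 5 := by
    intro U S m hU hS hm hpoly htail
    rw [RLS_iff]
    exact c025_core_five_cell_of_topCount_spanning_xqictq5g M 15 7 (by norm_num) hR hn hfree 11 56 302 hs3 hs4 hs5 U hU S hS
      16173 (by norm_num) (phiK 15 5) (by rw [S2.phiK_fifteen_five]; norm_num) ⟨m, hm, hpoly, tail_fifteen_seven_cf S m htail⟩
  by_cases h6 : ∃ W ⊆ M.E, W.ncard ≤ 11 ∧ W.encard = M.eRk W + 6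
  · obtain ⟨W, hW, hWn, hWk⟩ := h6
    have hU' : Matroid.topCount M 15 5 ≤ 15048 := by
      refine (full 6 hW hWk).trans ?_
      generalize W.ncard = w at hWn ⊢
      interval_cases w <;> decide
    have hS' : {X : Set α | X ⊆ M.E ∧ M.eRk X = M.eRank}.ncard ≤ 18162 := by
      refine (span 6 hW hWk).trans ?_
      generalize W.ncard = w at hWn ⊢
      interval_cases w <;> decide
    exact cell 15048 18162 37 hU' hS' (by norm_num) (by norm_num) (by norm_num)
  by_cases h5 : ∃ W ⊆ M.E, W.ncard ≤ 10 ∧ W.encard = M.eRk W + 5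
  · obtain ⟨W, hW, hWn, hWk⟩ := h5
    have hU' : Matroid.topCount M 15 5 ≤ 47058 := by
      refine (full 5 hW hWk).trans ?_
      generalize W.ncard = w at hWn ⊢
      interval_cases w <;> decide
    have hS' : {X : Set α | X ⊆ M.E ∧ M.eRk X = M.eRank}.ncard ≤ 53252 := by
      refine (span 5 hW hWk).trans ?_
      generalize W.ncard = w at hWn ⊢
      interval_cases w <;> decide
    exact cell 47058 53252 46 hU' hS' (by norm_num) (by norm_num) (by norm_num)
  by_cases h4 : ∃ W ⊆ M.E, W.ncard ≤ 9 ∧ W.encard = M.eRk W + 4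
  · obtain ⟨W, hW, hWn, hWk⟩ := h4
    have hflat : ∀ X ⊆ M.E, M.eRk X ≤ 5 → X.ncard ≤ 9 := fun X hX hr => by
      have := S2.ncard_le_of_eRk_le_of_not_nullity M 5 10 (by norm_num) h5 hX (r := 5) (by norm_num) (by exact_mod_cast hr)
      omega
    have hflat' : ∀ X ⊆ M.E, M.eRk X ≤ 4 → X.ncard ≤ 8 := fun X hX hr => by
      have := S2.ncard_le_of_eRk_le_of_not_nullity M 5 10 (by norm_num) h5 hX (r := 4) (by norm_num) (by exact_mod_cast hr)
      omega
    have hV := S2.ncard_spanning_compl_le_of_nullity M hW hd hWk (m := 5)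
    have hV' : ∑ j ∈ Finset.Icc (5 + 4 - 7) 5, W.ncard.choose j * (M.E.ncard - W.ncard).choose (5 - j) ≤ 18612 := by
      rw [hn]
      generalize W.ncard = w at hWn ⊢
      interval_cases w <;> decide
    have hU := topCount_le_payment_flat M 15 7 (by norm_num) hR hn hfree 9 8 hflat hflat' (by norm_num) (by norm_num)
      11 56 302 hs3 hs4 hs5 18612 (hV.trans hV')
    norm_num [Finset.sum_range_succ, Nat.choose] at hU
    have hU' : Matroid.topCount M 15 5 ≤ 60964 := hU.trans (by norm_num)
    have hS' : {X : Set α | X ⊆ M.E ∧ M.eRk X = M.eRank}.ncard ≤ 109572 := by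
      refine (span 4 hW hWk).trans ?_
      generalize W.ncard = w at hWn ⊢
      interval_cases w <;> decide
    exact cell 60964 109572 59 hU' hS' (by norm_num) (by norm_num) (by norm_num)
  · -- spread: rank-`5` sets `≤ 8`, rank-`4` sets `≤ 7`; the triangle trade-off
    have hflat : ∀ X ⊆ M.E, M.eRk X ≤ 5 → X.ncard ≤ 8 := fun X hX hr => by
      have := S2.ncard_le_of_eRk_le_of_not_nullity M 4 9 (by norm_num) h4 hX (r := 5) (by norm_num) (by exact_mod_cast hr)
      omega
    have hflat' : ∀ X ⊆ M.E, M.eRk X ≤ 4 → X.ncard ≤ 7 := fun X hX hr => by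
      have := S2.ncard_le_of_eRk_le_of_not_nullity M 4 9 (by norm_num) h4 hX (r := 4) (by norm_num) (by exact_mod_cast hr)
      omega
    by_cases ht : {C : Set α | M.IsCircuit C ∧ C.ncard = 3}.ncard ≤ 8
    · -- `≤ 8` triangles: the kit's spread count against the kit's tail
      have hU := topCount_le_flat M 15 7 (by norm_num) hR hn hfree 8 7 hflat hflat' (by norm_num) (by norm_num)
        8 56 302 ht hs4 hs5
      norm_num [Finset.sum_range_succ, Nat.choose] at hU
      have hUq : (Matroid.topCount M 15 5 : ℚ) ≤ 57692 := by linarith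
      have hU' : Matroid.topCount M 15 5 ≤ 57692 := by exact_mod_cast hUq
      have hEcard : M.ground_finite.toFinset.card = 15 + 7 := by
        rw [← Set.ncard_eq_toFinset_card _ M.ground_finite]; exact hn
      have hS := Matroid.ncard_spanning_le (M := M) hd
      rw [hEcard] at hS
      have hS' : {X : Set α | X ⊆ M.E ∧ M.eRk X = M.eRank}.ncard ≤ 280600 := hS.trans (by decide)
      exact cell 57692 280600 101 hU' hS' (by norm_num) (by norm_num) (by norm_num)
    · -- `≥ 9` triangles: the sharp spread count, the spread rank part of the tail, three triangles' Bonferroni on the bases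
      push Not at ht
      have hU := topCount_le_flat_sharp M 15 7 (by norm_num) (by norm_num) hR hn hfree 8 7 hflat hflat' (by norm_num) (by norm_num)
        11 56 302 hs3 hs4 hs5
      norm_num [Finset.sum_range_succ, Nat.choose] at hU
      have hU' : Matroid.topCount M 15 5 ≤ 59907 := hU.trans (by norm_num)
      have hA := ncard_eRk_le_five_le_spread M 15 7 (by norm_num) hR hn hfree hflat hflat' 11 56 302 hs3 hs4 hs5
      -- three distinct triangles
      have hL0 : ∀ e ∈ M.E, ¬ M.IsLoop e := not_isLoop_of_free M hfree
      have hs : ∀ e ∈ M.E, ∀ f ∈ M.E, e ≠ f → M.eRk {e, f} = 2 := by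
        intro e he f hf hef
        have h2 : (2 : ℕ∞) ≤ M.eRk {e, f} :=
          two_le_eRk_of_two_le_ncard_of_free M hfree (pair_subset he hf) (by rw [ncard_pair hef])
        have h3 : M.eRk {e, f} ≤ 2 := by
          have := M.eRk_le_encard {e, f}
          rwa [encard_pair hef] at this
        exact le_antisymm h3 h2
      have hC1 : ∀ L ⊆ M.E, M.eRk L = 2 → L.ncard ≤ 3 :=
        fun L hL hr => ncard_le_three_of_eRk_two M hs hfree hL hr
      have hTfin : {C : Set α | M.IsCircuit C ∧ C.ncard = 3}.Finite :=
        M.ground_finite.finite_subsets.subset (fun C hC => hC.1.subset_ground)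
      obtain ⟨T₁, T₂, T₃, hT₁, hT₂, hT₃, h12, h13, h23⟩ := (Set.two_lt_ncard_iff hTfin).1 (by omega)
      have hS := S2.ncard_spanning_add_le_of_three_triangles M hR hn (by norm_num) hC1 hT₁.1 hT₁.2 hT₂.1 hT₂.2 hT₃.1 hT₃.2 h12 h13 h23
      norm_num [Finset.sum_range_succ, Nat.choose] at hS
      have hS' : {X : Set α | X ⊆ M.E ∧ M.eRk X = M.eRank}.ncard ≤ 187780 := by omega
      rw [RLS_iff]
      exact c025_core_five_cell_of_counts_xqictq5g M 15 7 (by norm_num) hR hn 59907 hU' _ hA 187780 hS'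
        16173 (by norm_num) (phiK 15 5) (by rw [S2.phiK_fifteen_five]; norm_num) ⟨68, by norm_num, by norm_num, by norm_num [Nat.choose]⟩

/-- **THE CELL `(15, 7)`**: `RLS M 15 5` on every `e`-free core of rank `15` on `22` points — a coloop `e` is split off
(`delete_core_data`, the scaled cell `c025_fourteen_seven_scaled` on `M ＼ {e}`, `weighted_of_isColoop_scaled_sharp`); without
coloops `c025_fifteen_seven_cf`. -/
theorem c025_core_five_fifteen_seven (M : Matroid α) [M.Finite]
    (hR : M.eRank = ((15 : ℕ) : ℕ∞)) (hn : M.E.ncard = 15 + 7)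
    (hfree : ∀ e ∈ M.E, ∃ A ⊆ M.E \ {e}, e ∉ M.closure A ∧ e ∉ M.closure ((M.E \ {e}) \ A)) : RLS M 15 5 := by
  classical
  by_cases hK : ∃ e, M.IsColoop e
  · obtain ⟨e, he⟩ := hK
    obtain ⟨hn', hR', hfree', -⟩ := delete_core_data M he (p := 14) (d := 7) (by rw [hR]) hn hfree
    have key := c025_fourteen_seven_scaled (M ＼ {e}) hR' hn' hfree'
    rw [RLS_iff]
    exact weighted_of_isColoop_scaled_sharp M he (by norm_num : 4 + 1 < 14) (by rw [hR]) (phiK 15 5) key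
  · push Not at hK
    exact c025_fifteen_seven_cf M hR hn hfree hK

end ThmN

end PercRepro
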